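import Mathlib
import HarnessLib
import Summits.ValiantsHypothesis.ValiantsHypothesis.Theses.MonotoneRestoration
import Literature.Computability.AlgebraicComplexity.ArithCircuit
import Literature.Computability.AlgebraicComplexity.ArithCircuitProofs
import Literature.Computability.AlgebraicComplexity.MonotoneStructure
import Literature.Computability.AlgebraicComplexity.PermanentIrreducible
import Literature.ModelTheory.FiniteModelTheory.CkEquiv
import Summits.ValiantsHypothesis.ValiantsHypothesis.Theorems.MonotoneRestorationMonotoneRestorationQPCosetCount
import Summits.ValiantsHypothesis.ValiantsHypothesis.Theorems.MonotoneRestorationMonotoneRestorationQPSymmetricLB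
import Summits.ValiantsHypothesis.ValiantsHypothesis.Theorems.MonotoneRestorationMonotoneRestorationQPSupportSymmetrisation
import Summits.ValiantsHypothesis.ValiantsHypothesis.Theorems.MonotoneRestorationMonotoneRestorationQPSparseRegime
import Summits.ValiantsHypothesis.ValiantsHypothesis.Theorems.MonotoneRestorationMonotoneRestorationQPBeta
import Literature.Computability.AlgebraicComplexity.SymmetricArithCircuit
import Literature.Computability.AlgebraicComplexity.DawarWilsenach2025Proofs
import Literature.GroupTheory.PermutationGroups.SmallIndexSubgroups
import Summits.ValiantsHypothesis.ValiantsHypothesis.Theorems.MonotoneRestorationQP.Negative.LoadBearing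
import Summits.ValiantsHypothesis.ValiantsHypothesis.Theorems.MonotoneRestorationMonotoneRestorationQPPermSupportCount
import Literature.Computability.AlgebraicComplexity.ElementarySymmetricCircuit

/-! TTRL-lite variant V19258 of stmt-ValiantsHypothesis-15886

Target `stub_esymmRowSums_complexity`, move `generalise` (`[esymm_of_anything]`): the witness
family `e_d(R_1, …, R_n)` of the stub with the row sums `R_i` replaced by ARBITRARY substituends
`g_i : MvPolynomial τ ℝ≥0`: in the tree's fan-in-two (monotone, over `ℝ≥0`) measure `complexity`,
`L(e_d(g_1, …, g_n)) ≤ 2 (d + 1) n + Σ_i L(g_i)` — the dynamic-programme circuit for `e_d`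
(`e_{t+1}(a ∷ s) = e_{t+1}(s) + a · e_t(s)`, two gates per table entry, shared through
substitution, Bürgisser 2000, Rem. 2.7) placed on top of circuits for the `g_i`
(`complexity_aeval_le`). This is exactly the tree's Literature theorem
`Literature.Computability.AlgebraicComplexity.complexity_bind₁_esymm_le`
(`ElementarySymmetricCircuit.lean`) at `σ := Fin n`, `R := ℝ≥0`, with `Fintype.card (Fin n) = n`.
-/

-- `Summit.ValiantsHypothesis.ValiantsHypothesis.…` is the tree's mandated single-conjunct layout
-- (Sub = Summit), so the duplicated namespace component is intended.
set_option linter.dupNamespace false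

namespace Summit.ValiantsHypothesis.ValiantsHypothesis.Theorems

open Summit.ValiantsHypothesis.ValiantsHypothesis.Theses.MonotoneRestoration
open Literature.Computability.AlgebraicComplexity

/-- **TTRL-lite variant V19258 of `stub_esymmRowSums_complexity`** (stmt-ValiantsHypothesis-15886,
move `generalise`): over `ℝ≥0` (monotone circuits, fan-in-two measure `complexity`), for every
`n d : ℕ` and every family of substituends `g : Fin n → MvPolynomial τ ℝ≥0`,
`L(e_d(g_1, …, g_n)) ≤ 2 (d + 1) n + Σ_i L(g_i)`: the circuit for `e_d` in `n` variables
(`≤ 2 (d + 1) n` gates, the dynamic programme shared through substitution) composed with circuits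
for the `g_i` (`complexity_aeval_le`). Immediate from the tree's `complexity_bind₁_esymm_le`
and `Fintype.card_fin`. [cite: Burgisser2000, Def. 2.1 / Rem. 2.7] -/
theorem stub_esymmRowSums_complexity_var19258 :
    ∀ (n d : ℕ) (τ : Type) (g : Fin n → MvPolynomial τ NNReal),
      complexity (MvPolynomial.bind₁ g (MvPolynomial.esymm (Fin n) NNReal d)) ≤
        2 * (d + 1) * n + ∑ i, complexity (g i) := by
  intro n d τ g
  simpa only [Fintype.card_fin] using complexity_bind₁_esymm_le (R := NNReal) d g

end Summit.ValiantsHypothesis.ValiantsHypothesis.Theorems
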